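import Summits.CriticalPhenomena.PercolationContinuityZ3.Theorems.PercNearOneGluingNoHeavyLowerTailKnQuestion8CoefficientwiseRemSPPieces
import Summits.CriticalPhenomena.PercolationContinuityZ3.Theorems.PercNearOneGluingNoHeavyLowerTailKnQuestion8CoefficientwiseGluing
import Summits.CriticalPhenomena.PercolationContinuityZ3.Theorems.PercNearOneGluingNoHeavyLowerTailKnQuestion8CoefficientwiseComponentFlip
import HarnessLib

/-!
# THEOREM U3-CLOSURE, base case: the single edge is in 𝒰; rows by the identity map — prim-lf-2 gen 69

Support file (`--supports stmt-CriticalPhenomena-4575`, closed), prover `prim-lf-2` (gen 69).  No definitions, no named facts, no sorries; standard axioms.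
Memo `prim-lf-2/CW-SP-gen69.md` §1 (EDGE), §4.2 (base of the induction); definitions in `…CoefficientwiseRemSPPieces.lean`.
* `Coefficientwise.hasDomRow_of_self_dominating` — if every colouring `t` of the class already satisfies `C_x(D∖t) ⊆ C_x(t)`, the identity is a row.
* `Coefficientwise.hasDomRow_of_empty_class` — an empty class has a row.
* `Coefficientwise.inU3_singleton` — **the single edge `{e₀}` with ends `{x,h}`, `x ≠ h`, is in 𝒰** (`InU3 ends {e₀} x h`): the only colouring in any of the three classes is
  the red edge, and `C_x(∅) = {x}`.
[cite: KozmaNitzan2024, Questions 8–9 (§5.5 p. 36) (context: the Question-8 pocket covariance programme)]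
-/

namespace Summit.CriticalPhenomena.PercolationContinuityZ3.Theorems

open Finset Literature.Probability.Percolation

namespace Coefficientwise

variable {ι V : Type*} [DecidableEq ι] (ends : ι → Sym2 V)

/-- If every member of the class dominates itself (`C_x(D∖t) ⊆ C_x(t)`), the identity map is a row. [cite: KozmaNitzan2024, §5.5 (context only; folklore)] -/
theorem hasDomRow_of_self_dominating (D : Finset ι) (x : V) (cls : Finset ι → Prop)
    (h : ∀ t, t ⊆ D → cls t → openCluster (ends '' (↑(D \ t) : Set ι)) x ⊆ openCluster (ends '' (↑t : Set ι)) x) :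
    HasDomRow ends D x cls :=
  ⟨id, fun _ ht hc => ⟨ht, hc⟩, fun _ _ _ _ _ _ he => he, fun t ht hc => h t ht hc⟩

/-- An empty class has a row. [cite: KozmaNitzan2024, §5.5 (context only; folklore)] -/
theorem hasDomRow_of_empty_class (D : Finset ι) (x : V) (cls : Finset ι → Prop) (h : ∀ t, t ⊆ D → ¬ cls t) :
    HasDomRow ends D x cls :=
  hasDomRow_of_self_dominating ends D x cls fun t ht hc => absurd hc (h t ht)

omit [DecidableEq ι] in
/-- The red cluster of the empty colouring is the root alone: `y ∈ C_x(∅) → y = x`. [cite: KozmaNitzan2024, §5.5 (context only; folklore)] -/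
theorem eq_of_mem_openCluster_empty {x y : V} (hy : y ∈ openCluster (ends '' (↑(∅ : Finset ι) : Set ι)) x) : y = x := by
  by_contra hne
  exact not_mem_openCluster_of_forall_not_mem ends (s := (∅ : Finset ι)) (fun e he => absurd he (Finset.notMem_empty e)) hne hy

/-- **The single edge is in 𝒰.**  For an edge `e₀` with ends `{x, h}`, `x ≠ h`: `InU3 ends {e₀} x h`. [cite: KozmaNitzan2024, Questions 8–9 (§5.5 p. 36) (context)] -/
theorem inU3_singleton {e₀ : ι} {x h : V} (he₀ : ends e₀ = s(x, h)) (hxh : x ≠ h) : InU3 ends ({e₀} : Finset ι) x h := by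
  intro W
  -- for `t ⊆ {e₀}`: either `t = ∅` (then `h ∉ C_x t`, `h ∈ C_x({e₀} ∖ t)`) or `t = {e₀}` (then `{e₀} ∖ t = ∅`)
  have hcases : ∀ t : Finset ι, t ⊆ {e₀} → t = ∅ ∨ t = {e₀} := fun t ht => Finset.subset_singleton_iff.mp ht
  have hnot_empty_R : h ∉ openCluster (ends '' (↑(∅ : Finset ι) : Set ι)) x := fun hh => hxh (eq_of_mem_openCluster_empty ends hh).symm
  have hfull : h ∈ openCluster (ends '' (↑(({e₀} : Finset ι) \ ∅) : Set ι)) x := by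
    rw [Finset.sdiff_empty]
    exact mem_openCluster_of_edge ends (Finset.mem_singleton_self e₀) he₀ (mem_openCluster_self _ x)
  -- self-domination for `t = {e₀}`
  have hdom : ∀ t : Finset ι, t = {e₀} → openCluster (ends '' (↑(({e₀} : Finset ι) \ t) : Set ι)) x ⊆ openCluster (ends '' (↑t : Set ι)) x := by
    intro t ht y hy
    subst ht
    rw [Finset.sdiff_self] at hy
    rw [eq_of_mem_openCluster_empty ends hy]
    exact mem_openCluster_self _ x
  refine ⟨?_, ?_, ?_⟩
  · refine hasDomRow_of_self_dominating ends {e₀} x _ fun t ht hc => ?_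
    rcases hcases t ht with rfl | rfl
    · exact absurd hc.1 hnot_empty_R
    · exact hdom _ rfl
  · refine hasDomRow_of_self_dominating ends {e₀} x _ fun t ht hc => ?_
    rcases hcases t ht with rfl | rfl
    · exact absurd hc.1 hnot_empty_R
    · exact hdom _ rfl
  · refine hasDomRow_of_self_dominating ends {e₀} x _ fun t ht hc => ?_
    rcases hcases t ht with rfl | rfl
    · exact absurd hfull hc.2.1
    · exact hdom _ rfl

end Coefficientwise

end Summit.CriticalPhenomena.PercolationContinuityZ3.Theorems
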